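import Literature.RepresentationTheory.ClassicalInvariants.DegreesTypeA
import Literature.RepresentationTheory.ClassicalInvariants.NegOneMemIffDegreesEven
import Literature.RepresentationTheory.ClassicalInvariants.AlternatingPolynomialsHilbertSeries
import HarnessLib

/-!
# Consequences of the degrees `2, 3, …, n+1` of `S_{n+1}` (type `Aₙ`): `|W| = ∏ dᵢ`, `−1 ∉ W` (`n ≥ 2`), harmonics, alternating polynomials

## Source (verbatim)

J. E. Humphreys, *Reflection Groups and Coxeter Groups* (Cambridge, 1990), held scan
`book:humphreys1990-reflection-groups-coxeter-groups`: § 3.7 Table 1 (type `Aₙ`: degrees `2, 3, …, n+1`) and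
Exercise «The scalar transformation `−1` lies in `W` if and only if all degrees are even» (PDF p. 62); § 3.9
Theorem «`d₁d₂⋯dₙ = |W|` and `d₁ + d₂ + … + dₙ = N + n`» (p. 66); § 3.12 (type `Aₙ`) «The product of degrees of the
`fᵢ` is `(n+1)! = |W|`» (p. 69); § 3.15 Lemma, proof steps (D)–(E): `Σ_k dim(A_k) t^k · ∏ (1 − t^{dᵢ}) = t^N` for the
alternating polynomials `A` (p. 73). R. Goodman, N. R. Wallach, *Symmetry, Representations, and Invariants*
(GTM 255), Corollary 5.1.7 / Exercises 5.1.3 #9(b), #10(b): `dim ℋ = |W|`, `p_ℋ(t) = ∏ (1 + t + ⋯ + t^{dᵢ−1})`,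
unique top harmonic; G. I. Lehrer, D. E. Taylor, *Unitary Reflection Groups* (2009), Corollary 4.23.

## What is here

For any homomorphism `ρ : 𝔖ₙ₊₁ →* Aut ℝ[x₀, …, x_{n−1}]` realising the essential representation
(`ρ σ p = aeval (y ∘ σ ∘ castSucc) p`, `y = (x₀, …, x_{n−1}, −Σ xᵢ)`; it exists, `JacobianTypeA.exists_essentialHom`),
whose degrees are `2, 3, …, n+1` (`DegreesTypeA.degrees_typeA`), the tree's general theorems give:
`prod_degrees_typeA` (`∏ dᵢ = (n+1)! = |S_{n+1}|`), `sum_degrees_sub_one_typeA` (`Σ (dᵢ − 1) = n(n+1)/2 = N`),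
**`exists_neg_one_typeA_iff`** (`−1 ∈ W ⟺ n ≤ 1`, § 3.7 Exercise), **`finrank_harmonic_typeA`** (`dim ℋ = (n+1)!`),
`hilbertSeries_harmonic_typeA` (`p_ℋ(t) = ∏_{k=2}^{n+1} (1 + t + ⋯ + t^{k−1})`), `harmonic_typeA_eq_bot_of_lt` and
`finrank_harmonic_typeA_top` (top harmonic degree `n(n+1)/2`, multiplicity one), and
**`hilbertSeries_alternating_typeA`** (`Σ_k dim(A_k) t^k · ∏_{k=2}^{n+1} (1 − t^k) = t^{n(n+1)/2}`).

All statements are theorems; no definitions, no named facts.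
-/

open MvPolynomial
open scoped BigOperators Nat

namespace Literature.RepresentationTheory.ClassicalInvariants.HarmonicDimensionTypeA

open Literature.RepresentationTheory.ClassicalInvariants.MolienFormula (linMatrixHom)
open Literature.RepresentationTheory.ClassicalInvariants.JacobianTypeA (prod_add_two)
open Literature.RepresentationTheory.ClassicalInvariants.DegreesTypeA
  (isHomogeneous_essentialHom exists_rootForm_of_isSwap_essentialHom essentialHom_injective degrees_typeA
    two_mul_natCard_reflections_typeA)
open Literature.RepresentationTheory.ClassicalInvariants.ReflectionGroupDegrees
  (degrees finrank_harmonic_eq_prod_degrees hilbertSeries_harmonic_eq_prod_degrees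
    harmonic_inf_eq_bot_of_lt_of_degrees finrank_harmonic_inf_sum_degrees_sub_one)
open Literature.RepresentationTheory.ClassicalInvariants.DegreesSumAndProduct
  (sum_degrees_sub_one_eq_natCard_reflections)
open Literature.RepresentationTheory.ClassicalInvariants.NegOneMemIffDegreesEven (exists_neg_one_iff_forall_even)
open Literature.RepresentationTheory.ClassicalInvariants.AlternatingPolynomialsHilbertSeries
  (hilbertSeries_alternating_mul_prod_degrees)

/-! ### § 1 `∏ dᵢ = (n+1)!`, `Σ (dᵢ − 1) = n(n+1)/2` -/

/-- **«The product of degrees of the `fᵢ` is `(n+1)! = |W|`»** for the degrees `2, 3, …, n+1` of `S_{n+1}`.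
[cite: Humphreys1990, § 3.12 (type Aₙ) with § 3.9 Theorem ("d_1 d_2 ⋯ d_n = |W|")] -/
theorem prod_degrees_typeA (n : ℕ)
    (ρ : Equiv.Perm (Fin (n + 1)) →* (MvPolynomial (Fin n) ℝ ≃ₐ[ℝ] MvPolynomial (Fin n) ℝ))
    (hρ : ∀ σ p, ρ σ p = aeval (fun i : Fin n => (Fin.snoc (fun i : Fin n => (X i : MvPolynomial (Fin n) ℝ))
        (-∑ i : Fin n, (X i : MvPolynomial (Fin n) ℝ)) : Fin (n + 1) → MvPolynomial (Fin n) ℝ) (σ (Fin.castSucc i))) p) :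
    (degrees ρ (isHomogeneous_essentialHom ρ hρ) Equiv.Perm.closure_isSwap
        (exists_rootForm_of_isSwap_essentialHom ρ hρ)).prod = (n + 1)! ∧
      (n + 1)! = Nat.card (Equiv.Perm (Fin (n + 1))) := by
  refine ⟨?_, by rw [Nat.card_eq_fintype_card, Fintype.card_perm, Fintype.card_fin]⟩
  rw [degrees_typeA n ρ hρ, ← prod_add_two n, Finset.prod_eq_multiset_prod]

/-- **`Σᵢ (dᵢ − 1) = N = n(n+1)/2`** for `S_{n+1}` (degrees `2, …, n+1`; `N` = the number of transpositions).
[cite: Humphreys1990, § 3.9 Theorem and Exercise with § 2.11 Table 2 (type Aₙ: N = n(n+1)/2)] -/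
theorem sum_degrees_sub_one_typeA (n : ℕ)
    (ρ : Equiv.Perm (Fin (n + 1)) →* (MvPolynomial (Fin n) ℝ ≃ₐ[ℝ] MvPolynomial (Fin n) ℝ))
    (hρ : ∀ σ p, ρ σ p = aeval (fun i : Fin n => (Fin.snoc (fun i : Fin n => (X i : MvPolynomial (Fin n) ℝ))
        (-∑ i : Fin n, (X i : MvPolynomial (Fin n) ℝ)) : Fin (n + 1) → MvPolynomial (Fin n) ℝ) (σ (Fin.castSucc i))) p) :
    ((degrees ρ (isHomogeneous_essentialHom ρ hρ) Equiv.Perm.closure_isSwap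
        (exists_rootForm_of_isSwap_essentialHom ρ hρ)).map fun d => d - 1).sum = n * (n + 1) / 2 := by
  classical
  have h2 := two_mul_natCard_reflections_typeA n ρ hρ
  rw [← sum_degrees_sub_one_eq_natCard_reflections ρ (isHomogeneous_essentialHom ρ hρ)
    (essentialHom_injective ρ hρ) Equiv.Perm.closure_isSwap (exists_rootForm_of_isSwap_essentialHom ρ hρ)] at h2
  exact (Nat.div_eq_of_eq_mul_left two_pos (h2.symm.trans (mul_comm _ _))).symm

/-! ### § 2 `−1 ∈ W(Aₙ) ⟺ n ≤ 1` -/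

/-- **Humphreys § 3.7 Exercise for type `Aₙ`: `−1 ∈ W = S_{n+1}` (essential representation) if and only if
`n ≤ 1`** — «`−1` lies in `W` if and only if all degrees are even», and the degrees `2, 3, …, n+1` contain the odd
degree `3` exactly when `n ≥ 2`. [cite: Humphreys1990, § 3.7 Exercise ("−1 lies in W if and only if all degrees are even") with Table 1 (type Aₙ)] -/
theorem exists_neg_one_typeA_iff (n : ℕ)
    (ρ : Equiv.Perm (Fin (n + 1)) →* (MvPolynomial (Fin n) ℝ ≃ₐ[ℝ] MvPolynomial (Fin n) ℝ))
    (hρ : ∀ σ p, ρ σ p = aeval (fun i : Fin n => (Fin.snoc (fun i : Fin n => (X i : MvPolynomial (Fin n) ℝ))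
        (-∑ i : Fin n, (X i : MvPolynomial (Fin n) ℝ)) : Fin (n + 1) → MvPolynomial (Fin n) ℝ) (σ (Fin.castSucc i))) p) :
    (∃ σ : Equiv.Perm (Fin (n + 1)), ∀ i : Fin n,
        ρ σ (X i : MvPolynomial (Fin n) ℝ) = -(X i : MvPolynomial (Fin n) ℝ)) ↔ n ≤ 1 := by
  classical
  rw [exists_neg_one_iff_forall_even ρ (isHomogeneous_essentialHom ρ hρ) (essentialHom_injective ρ hρ)
    Equiv.Perm.closure_isSwap (exists_rootForm_of_isSwap_essentialHom ρ hρ), degrees_typeA n ρ hρ]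
  simp only [Multiset.mem_map, Finset.mem_val, Finset.mem_univ, true_and, forall_exists_index,
    forall_apply_eq_imp_iff]
  constructor
  · intro h
    by_contra hn
    have h3 := h ⟨1, by omega⟩
    exact (Nat.not_even_iff_odd.mpr (by decide : Odd 3)) h3
  · intro hn k
    have hk : (k : ℕ) = 0 := by omega
    rw [hk]
    exact even_two

/-! ### § 3 The harmonics of `S_{n+1}`: `dim ℋ = (n+1)!`, `p_ℋ(t) = ∏_{k=2}^{n+1} (1 + t + ⋯ + t^{k−1})` -/

/-- **`dim ℋ = (n+1)! = |S_{n+1}|`** for the harmonics of the essential representation of `S_{n+1}`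
(`ℋ = ⋂_g ker g(∂)` over the homogeneous invariants `g` of positive degree).
[cite: GoodmanWallachGTM255, Corollary 5.1.7 ("dim ℋ = |W|")] [cite: Humphreys1990, § 3.7 Table 1 (type Aₙ) with § 3.9 Theorem] -/
theorem finrank_harmonic_typeA (n : ℕ)
    (ρ : Equiv.Perm (Fin (n + 1)) →* (MvPolynomial (Fin n) ℝ ≃ₐ[ℝ] MvPolynomial (Fin n) ℝ))
    (hρ : ∀ σ p, ρ σ p = aeval (fun i : Fin n => (Fin.snoc (fun i : Fin n => (X i : MvPolynomial (Fin n) ℝ))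
        (-∑ i : Fin n, (X i : MvPolynomial (Fin n) ℝ)) : Fin (n + 1) → MvPolynomial (Fin n) ℝ) (σ (Fin.castSucc i))) p)
    (D : MvPolynomial (Fin n) ℝ →ₐ[ℝ] Module.End ℝ (MvPolynomial (Fin n) ℝ))
    (hD : ∀ i, D (X i) =
      ((pderiv i : Derivation ℝ (MvPolynomial (Fin n) ℝ) (MvPolynomial (Fin n) ℝ)) :
        Module.End ℝ (MvPolynomial (Fin n) ℝ))) :
    Module.finrank ℝ ↥(⨅ g ∈ {g : MvPolynomial (Fin n) ℝ | (∀ s, ρ s g = g) ∧ ∃ d, 0 < d ∧ g.IsHomogeneous d},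
        LinearMap.ker (D g)) = (n + 1)! := by
  rw [finrank_harmonic_eq_prod_degrees ρ (isHomogeneous_essentialHom ρ hρ) Equiv.Perm.closure_isSwap
    (exists_rootForm_of_isSwap_essentialHom ρ hρ) D hD]
  exact (prod_degrees_typeA n ρ hρ).1

/-- **`p_ℋ(t) = ∏_{k=2}^{n+1} (1 + t + ⋯ + t^{k−1})`**: the Poincaré polynomial of the harmonics of `S_{n+1}`.
[cite: GoodmanWallachGTM255, Corollary 5.1.7 (proof) with Exercises 5.1.3 #9(b)] [cite: Humphreys1990, § 3.7 Table 1 (type Aₙ)] -/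
theorem hilbertSeries_harmonic_typeA (n : ℕ)
    (ρ : Equiv.Perm (Fin (n + 1)) →* (MvPolynomial (Fin n) ℝ ≃ₐ[ℝ] MvPolynomial (Fin n) ℝ))
    (hρ : ∀ σ p, ρ σ p = aeval (fun i : Fin n => (Fin.snoc (fun i : Fin n => (X i : MvPolynomial (Fin n) ℝ))
        (-∑ i : Fin n, (X i : MvPolynomial (Fin n) ℝ)) : Fin (n + 1) → MvPolynomial (Fin n) ℝ) (σ (Fin.castSucc i))) p)
    (D : MvPolynomial (Fin n) ℝ →ₐ[ℝ] Module.End ℝ (MvPolynomial (Fin n) ℝ))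
    (hD : ∀ i, D (X i) =
      ((pderiv i : Derivation ℝ (MvPolynomial (Fin n) ℝ) (MvPolynomial (Fin n) ℝ)) :
        Module.End ℝ (MvPolynomial (Fin n) ℝ))) :
    (PowerSeries.mk fun m => (Module.finrank ℝ ↥(homogeneousSubmodule (Fin n) ℝ m ⊓
        ⨅ g ∈ {g : MvPolynomial (Fin n) ℝ | (∀ s, ρ s g = g) ∧ ∃ d, 0 < d ∧ g.IsHomogeneous d},
          LinearMap.ker (D g)) : ℤ)) =
      ∏ k : Fin n, ∑ i ∈ Finset.range ((k : ℕ) + 2), (PowerSeries.X : PowerSeries ℤ) ^ i := by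
  rw [hilbertSeries_harmonic_eq_prod_degrees ρ (isHomogeneous_essentialHom ρ hρ) Equiv.Perm.closure_isSwap
    (exists_rootForm_of_isSwap_essentialHom ρ hρ) D hD, degrees_typeA n ρ hρ, Multiset.map_map,
    Finset.prod_eq_multiset_prod]
  rfl

/-- **`ℋ_m = 0` for `m > n(n+1)/2`**: the harmonics of `S_{n+1}` live in degrees `≤ N = n(n+1)/2`.
[cite: LehrerTaylor2009, Corollary 4.23 (i)] [cite: Humphreys1990, § 3.9 Theorem with Table 1 (type Aₙ)] -/
theorem harmonic_typeA_eq_bot_of_lt (n : ℕ)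
    (ρ : Equiv.Perm (Fin (n + 1)) →* (MvPolynomial (Fin n) ℝ ≃ₐ[ℝ] MvPolynomial (Fin n) ℝ))
    (hρ : ∀ σ p, ρ σ p = aeval (fun i : Fin n => (Fin.snoc (fun i : Fin n => (X i : MvPolynomial (Fin n) ℝ))
        (-∑ i : Fin n, (X i : MvPolynomial (Fin n) ℝ)) : Fin (n + 1) → MvPolynomial (Fin n) ℝ) (σ (Fin.castSucc i))) p)
    (D : MvPolynomial (Fin n) ℝ →ₐ[ℝ] Module.End ℝ (MvPolynomial (Fin n) ℝ))
    (hD : ∀ i, D (X i) =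
      ((pderiv i : Derivation ℝ (MvPolynomial (Fin n) ℝ) (MvPolynomial (Fin n) ℝ)) :
        Module.End ℝ (MvPolynomial (Fin n) ℝ)))
    {m : ℕ} (hm : n * (n + 1) / 2 < m) :
    homogeneousSubmodule (Fin n) ℝ m ⊓
        ⨅ g ∈ {g : MvPolynomial (Fin n) ℝ | (∀ s, ρ s g = g) ∧ ∃ d, 0 < d ∧ g.IsHomogeneous d},
          LinearMap.ker (D g) = ⊥ := by
  refine harmonic_inf_eq_bot_of_lt_of_degrees ρ (isHomogeneous_essentialHom ρ hρ) Equiv.Perm.closure_isSwap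
    (exists_rootForm_of_isSwap_essentialHom ρ hρ) D hD ?_
  rwa [sum_degrees_sub_one_typeA n ρ hρ]

/-- **`dim ℋ_{n(n+1)/2} = 1`**: the top harmonic of `S_{n+1}` (degree `N = n(n+1)/2`) is unique up to a constant.
[cite: LehrerTaylor2009, Corollary 4.23 (iii)] [cite: GoodmanWallachGTM255, Exercises 5.1.3 #9(b) ("unique (up to a constant multiple)")] [cite: Humphreys1990, § 3.9 Theorem with Table 1 (type Aₙ)] -/
theorem finrank_harmonic_typeA_top (n : ℕ)
    (ρ : Equiv.Perm (Fin (n + 1)) →* (MvPolynomial (Fin n) ℝ ≃ₐ[ℝ] MvPolynomial (Fin n) ℝ))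
    (hρ : ∀ σ p, ρ σ p = aeval (fun i : Fin n => (Fin.snoc (fun i : Fin n => (X i : MvPolynomial (Fin n) ℝ))
        (-∑ i : Fin n, (X i : MvPolynomial (Fin n) ℝ)) : Fin (n + 1) → MvPolynomial (Fin n) ℝ) (σ (Fin.castSucc i))) p)
    (D : MvPolynomial (Fin n) ℝ →ₐ[ℝ] Module.End ℝ (MvPolynomial (Fin n) ℝ))
    (hD : ∀ i, D (X i) =
      ((pderiv i : Derivation ℝ (MvPolynomial (Fin n) ℝ) (MvPolynomial (Fin n) ℝ)) :
        Module.End ℝ (MvPolynomial (Fin n) ℝ))) :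
    Module.finrank ℝ ↥(homogeneousSubmodule (Fin n) ℝ (n * (n + 1) / 2) ⊓
        ⨅ g ∈ {g : MvPolynomial (Fin n) ℝ | (∀ s, ρ s g = g) ∧ ∃ d, 0 < d ∧ g.IsHomogeneous d},
          LinearMap.ker (D g)) = 1 := by
  rw [← sum_degrees_sub_one_typeA n ρ hρ]
  exact finrank_harmonic_inf_sum_degrees_sub_one ρ (isHomogeneous_essentialHom ρ hρ) Equiv.Perm.closure_isSwap
    (exists_rootForm_of_isSwap_essentialHom ρ hρ) D hD

/-! ### § 4 The alternating polynomials of `S_{n+1}`: `Σ_k dim(A_k) t^k · ∏_{k=2}^{n+1} (1 − t^k) = t^{n(n+1)/2}` -/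

/-- **Humphreys § 3.15 (D)–(E) for type `Aₙ`: `Σ_k dim(A_k) t^k · ∏_{k=2}^{n+1} (1 − t^k) = t^{n(n+1)/2}`** for the
alternating polynomials `A = {p : ρ(w) p = det(A_w) p ∀ w}` of the essential representation of `S_{n+1}`
(`N = n(n+1)/2` reflections, degrees `2, …, n+1`).
[cite: Humphreys1990, § 3.15 (proof of the Lemma, steps (D)–(E)) with Table 1 and § 2.11 Table 2 (type Aₙ)] -/
theorem hilbertSeries_alternating_typeA (n : ℕ)
    (ρ : Equiv.Perm (Fin (n + 1)) →* (MvPolynomial (Fin n) ℝ ≃ₐ[ℝ] MvPolynomial (Fin n) ℝ))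
    (hρ : ∀ σ p, ρ σ p = aeval (fun i : Fin n => (Fin.snoc (fun i : Fin n => (X i : MvPolynomial (Fin n) ℝ))
        (-∑ i : Fin n, (X i : MvPolynomial (Fin n) ℝ)) : Fin (n + 1) → MvPolynomial (Fin n) ℝ) (σ (Fin.castSucc i))) p) :
    (PowerSeries.mk fun k => (Module.finrank ℝ ↥(homogeneousSubmodule (Fin n) ℝ k ⊓
        ⨅ w : Equiv.Perm (Fin (n + 1)), LinearMap.eqLocus (ρ w).toLinearMap
          ((linMatrixHom ρ (isHomogeneous_essentialHom ρ hρ) w).det • LinearMap.id)) : ℤ)) *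
      ∏ k : Fin n, (1 - (PowerSeries.X : PowerSeries ℤ) ^ ((k : ℕ) + 2)) =
      PowerSeries.X ^ (n * (n + 1) / 2) := by
  classical
  have h := hilbertSeries_alternating_mul_prod_degrees ρ (isHomogeneous_essentialHom ρ hρ)
    (essentialHom_injective ρ hρ) Equiv.Perm.closure_isSwap (exists_rootForm_of_isSwap_essentialHom ρ hρ)
  rw [degrees_typeA n ρ hρ, Multiset.map_map, ← Finset.prod_eq_multiset_prod] at h
  have hN : Nat.card {g : Equiv.Perm (Fin (n + 1)) // ρ g ≠ 1 ∧
      ∃ β : MvPolynomial (Fin n) ℝ, β.IsHomogeneous 1 ∧ β ≠ 0 ∧ ∀ p, β ∣ p - ρ g p} = n * (n + 1) / 2 :=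
    (Nat.div_eq_of_eq_mul_left two_pos ((two_mul_natCard_reflections_typeA n ρ hρ).symm.trans
      (mul_comm _ _))).symm
  rw [hN] at h
  exact h

end Literature.RepresentationTheory.ClassicalInvariants.HarmonicDimensionTypeA
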